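import Literature.NumberTheory.Sieve.BombieriFriedlanderIwaniecTheorem1Assembly
import HarnessLib

/-!
# Bombieri–Friedlander–Iwaniec 1986/2019: the CORRECTED Lemma 1 and the reductions of Theorems 1, 5, 5* to it

Topic `Literature/NumberTheory/Sieve`.  Everything here is PROVED; no named fact is introduced (one
parametrised hypothesis predicate, `BFI.Lemma1BoundCorrected`, is defined, in the manner of
`BFI.Lemma1BoundFor` of `…Lemma6`).

## The point of this file

The tree reduces BFI's Theorems 1, 2, 5, 5*, 10 (and Corollary 2, the twin-prime constant `7/2`)
to the single hypothesis `BFI.Lemma1BoundFor BFI.plateau2 (5/4)` (`…Lemma6`, `…DispersionLemma7`,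
`…Theorem1Assembly`, `…Theorem2FromLemma1`, `…Theorem10FromLemma1`,
`HardyLittlewoodTwinSieveBFIFromLemma1`): BFI's Lemma 1 (Acta Math. 156 (1986), §2, p. 210) as
printed there, i.e. Deshouillers–Iwaniec, Invent. Math. 70 (1982), Theorem 12 as printed there, with
`𝓘² = CS(RS + N)(C + DR) + C²DS√((RS + N)R) + D²NRS⁻¹` (`BFI.lemma1I`).

That printed statement is WRONG, and the predicate `BFI.Lemma1BoundFor BFI.plateau2 (5/4)` is in
fact false (a counterexample family: `C = 1`, `R = 1/2`, `s` prime `∼ S → ∞`, `D = N = S²`,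
`B(n,1,s) = c_s(n)` Ramanujan sums; see the companion file `…Lemma1Refutation`).  The authors
published the correction themselves: E. Bombieri, J. B. Friedlander, H. Iwaniec, *Some corrections
to an old paper*, arXiv:1903.01371 (2019), §2, **Lemma 2.1**: the same statement with the last term
of `𝓘²` replaced by `D²NR` — "This is somewhat weaker than the version quoted in [DI] and [BFI]
where, in the final term, the quantity `D²NR` was stated as `D²NRS⁻¹`.  The above corrected version
is already sufficient for our applications.  This modification of the final term is the follow-up
of the correction of the bound (9.11) of [DI], wherein the quantity `D(NR/S)^{1/2}` needs to be
replaced by `D(NR)^{1/2}`. … In most of our uses of this lemma we have `S = 1` so things remain as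
before."  (The statements of all theorems of BFI 1986 are unaffected, loc. cit., Abstract.)

In the tree the hypothesis is indeed only ever INSTANTIATED at `S = 1/2`, i.e. `s = 1`
(`BFI.L6.blockA_le_of_K1` for Lemma 6, `BFI.L7.blockB_le_of_K1` for Lemma 7), where the corrected
last term `D²NR` is SMALLER than the misprinted `D²NR/(1/2) = 2D²NR`; so the corrected Lemma 2.1
gives everything the printed proofs use.  This file

* defines the corrected quantity `BFI.lemma1Icorr` and the corrected hypothesis predicate
  `BFI.Lemma1BoundCorrected g₀ b` (BFI 2019 Lemma 2.1 for one weight `g(c,d) = g₀(c/C, d/D)`, in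
  the sub-range `C, D, N ≥ 1`, `R, S ≥ 1/2` of the printed `C, D, N, R, S > 0`);
* isolates the `S = 1/2` instance of the bound actually consumed (`BFI.K1HalfFor BFI.plateau2 (5/4)`), derives it from the
  corrected predicate (`BFI.k1HalfFor_of_corrected`, `BFI.k1Half_of_corrected`; also, trivially, from the old one,
  `BFI.k1Half_of_lemma1BoundFor`);
* re-proves BFI's Lemma 6 ((8.4), p. 227) from that instance alone (`BFI.L6.blockA_le_of_K1half`,
  `BFI.L6.dispA_le_pos_half`, `BFI.L6.dispA_le_of_K1half` — the proofs of `…Lemma6` verbatim, with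
  the hypothesis weakened to what they use), whence
* **Theorems 5, 5*, 5* on boxes and Theorem 1 from the corrected Lemma 1**:
  `BombieriFriedlanderIwaniecTheorem5_of_lemma1corr`, `…Theorem5Star_of_lemma1corr`,
  `…Theorem5StarInterval_of_lemma1corr`, `…Theorem1_of_lemma1corr` (via the tree's
  `BombieriFriedlanderIwaniecTheorem5_of_lemma6`, `BombieriFriedlanderIwaniecTheorem1_of_lemma6`).

Theorem 2, Theorem 10 (all forms) and Corollary 2 from the corrected Lemma 1 are in the sequel
`…Theorem10FromLemma1Corrected` (Lemma 7 side).  What then remains unproved for the whole cone is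
exactly the corrected Lemma 1 = Deshouillers–Iwaniec's Theorem 12 with last term `D²NR`
(Kuznetsov's formula and the spectral large sieve on `Γ₀(rs)∖ℍ`, in neither Mathlib nor the tree),
for the one weight `w ⊗ w`: the hypothesis `BFI.Lemma1BoundCorrected BFI.plateau2 (5/4)`.

## References

* E. Bombieri, J. B. Friedlander, H. Iwaniec, *Some corrections to an old paper*, arXiv:1903.01371
  (2019), §2 Lemma 2.1 (the corrected Lemma 1) and the Abstract. [BombieriFriedlanderIwaniec2019]
* E. Bombieri, J. B. Friedlander, H. Iwaniec, Acta Math. 156 (1986), 203–251: §2 Lemma 1 p. 210;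
  §8 Lemma 6, (8.4), p. 227; Theorem 1 p. 225; §12 Theorems 5, 5* pp. 237–238.
  [BombieriFriedlanderIwaniecActa1986]
* J.-M. Deshouillers, H. Iwaniec, *Kloosterman sums and Fourier coefficients of cusp forms*, Invent.
  Math. 70 (1982), 219–288, Theorem 12 and (9.11) (BFI's reference [2]; misprint corrected in 2019).
* Y. Jiang, G. Lü, Z. Wang (2025), arXiv:2512.22798, Lemma 2.11 ("This is [DI82], corrected in
  [BFI19]"), restating the corrected bound with last term `D²WU`.
-/

noncomputable section

open Finset Real
open scoped ArithmeticFunction.sigma ContDiff FourierTransform ComplexConjugate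

namespace Literature.NumberTheory.Sieve

namespace BFI

/-! ### The corrected Lemma 1 (BFI 2019, Lemma 2.1) -/

/-- **The corrected quantity `𝓘(C, D, N, R, S)`** of BFI's Lemma 1 (BFI 2019, Lemma 2.1):
`𝓘² = CS(RS + N)(C + DR) + C²DS √((RS + N)R) + D²NR` — the last term is `D²NR`, not the
misprinted `D²NRS⁻¹` of BFI 1986 p. 210 / Deshouillers–Iwaniec 1982 Theorem 12 (`BFI.lemma1I`).
[cite: BombieriFriedlanderIwaniec2019, §2 Lemma 2.1] -/
def lemma1Icorr (C D N R S : ℝ) : ℝ :=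
  Real.sqrt (C * S * (R * S + N) * (C + D * R) + C ^ 2 * D * S * Real.sqrt ((R * S + N) * R) +
    D ^ 2 * N * R)

/-- **The corrected bound of Lemma 1 for a given weight** `g₀(ξ, η)` supported in `(0, b]²`
(BFI 2019, Lemma 2.1: "Let `g₀(ξ,η)` be a smooth function with compact support in `ℝ⁺ × ℝ⁺`.  Let
`C, D, N, R, S > 0` and `g(c,d) = g₀(c/C, d/D)`. … Then, for any `ε > 0` we have
`𝓚(C,D,N,R,S) ≪ (CDNRS)^ε 𝓘(C,D,N,R,S) ‖B‖` … `𝓘² = CS(RS+N)(C+DR) + C²DS√((RS+N)R) + D²NR`, the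
constant implied in `≪` depending at most on `ε` and `g(ξ, η)`"), with the sums over `c, d` cut at
`bC, bD` (beyond the support) and in the sub-range `C, D, N ≥ 1`, `R, S ≥ 1/2` — word for word the
tree's `BFI.Lemma1BoundFor g₀ b` with `BFI.lemma1I` replaced by `BFI.lemma1Icorr`.  A predicate in
`(g₀, b)`, used as a HYPOTHESIS (it is Deshouillers–Iwaniec, Invent. Math. 70 (1982), Theorem 12,
corrected, resting on Kuznetsov's formula; not in Mathlib or the tree).
[cite: BombieriFriedlanderIwaniec2019, §2 Lemma 2.1] -/
def Lemma1BoundCorrected (g₀ : ℝ → ℝ → ℝ) (b : ℝ) : Prop :=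
  ∀ ε : ℝ, 0 < ε → ∃ K : ℝ, ∀ C D N R S : ℝ, 1 ≤ C → 1 ≤ D → 1 ≤ N → 1 / 2 ≤ R → 1 / 2 ≤ S →
    ∀ B : ℕ → ℕ → ℕ → ℂ,
      ‖dispK (fun c d => g₀ (c / C) (d / D)) ⌊b * C⌋₊ ⌊b * D⌋₊ ⌊N⌋₊ R S B‖ ≤
        K * (C * D * N * R * S) ^ ε * lemma1Icorr C D N R S * lemma1Norm ⌊N⌋₊ R S B

/-- Unfolding of `Lemma1BoundCorrected`. [folklore] -/
theorem lemma1BoundCorrected_iff (g₀ : ℝ → ℝ → ℝ) (b : ℝ) :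
    Lemma1BoundCorrected g₀ b ↔
      ∀ ε : ℝ, 0 < ε → ∃ K : ℝ, ∀ C D N R S : ℝ, 1 ≤ C → 1 ≤ D → 1 ≤ N → 1 / 2 ≤ R → 1 / 2 ≤ S →
        ∀ B : ℕ → ℕ → ℕ → ℂ,
          ‖dispK (fun c d => g₀ (c / C) (d / D)) ⌊b * C⌋₊ ⌊b * D⌋₊ ⌊N⌋₊ R S B‖ ≤
            K * (C * D * N * R * S) ^ ε * lemma1Icorr C D N R S * lemma1Norm ⌊N⌋₊ R S B :=
  Iff.rfl

/-- `0 ≤ 𝓘_corr`. [folklore] -/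
theorem lemma1Icorr_nonneg (C D N R S : ℝ) : 0 ≤ lemma1Icorr C D N R S := Real.sqrt_nonneg _

/-- **For `S ≤ 1` the corrected `𝓘` is at most the misprinted one**: `D²NR ≤ D²NR/S` when
`0 < S ≤ 1` (and `D² N R ≥ 0`).  In particular at `S = 1/2`, the only value at which the tree
instantiates Lemma 1. [cite: BombieriFriedlanderIwaniec2019, §2 ("In most of our uses of this lemma we have `S = 1`
so things remain as before")] -/
theorem lemma1Icorr_le_lemma1I {C D N R S : ℝ} (hN : 0 ≤ N) (hR : 0 ≤ R) (hS0 : 0 < S) (hS1 : S ≤ 1) :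
    lemma1Icorr C D N R S ≤ lemma1I C D N R S := by
  unfold lemma1Icorr lemma1I
  refine Real.sqrt_le_sqrt ?_
  have h0 : 0 ≤ D ^ 2 * N * R := by positivity
  have h1 : D ^ 2 * N * R ≤ D ^ 2 * N * R / S := by
    rw [le_div_iff₀ hS0]
    calc D ^ 2 * N * R * S ≤ D ^ 2 * N * R * 1 := mul_le_mul_of_nonneg_left hS1 h0
      _ = D ^ 2 * N * R := mul_one _
  linarith

/-- **The `S = 1/2` instance of Lemma 1 for the weight `w ⊗ w`** — the only instance the proofs of
Lemmas 6 and 7 use (`s ∼ 1/2` means `s = 1`): for every `ε > 0` a constant `K` with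
`‖𝓚(C', D', N, R, 1/2; B)‖ ≤ K (C'D'NR/2)^ε 𝓘(C', D', N, R, 1/2) ‖B‖` for `C', D', N ≥ 1`, `R ≥ 1/2`,
with the (larger, misprinted) `𝓘` of `BFI.lemma1I`, so that the bookkeeping of `…Lemma6` /
`…DispersionLemma7` applies unchanged. [cite: BombieriFriedlanderIwaniecActa1986, §8 p. 227 ("by Lemma 1", with `s = 1`)] -/
def K1HalfFor (g₀ : ℝ → ℝ → ℝ) (b : ℝ) : Prop :=
  ∀ ε : ℝ, 0 < ε → ∃ K : ℝ, ∀ C' D' N R : ℝ, 1 ≤ C' → 1 ≤ D' → 1 ≤ N → 1 / 2 ≤ R →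
    ∀ B : ℕ → ℕ → ℕ → ℂ,
      ‖dispK (fun c d => g₀ (c / C') (d / D')) ⌊b * C'⌋₊ ⌊b * D'⌋₊ ⌊N⌋₊ R (1 / 2) B‖ ≤
        K * (C' * D' * N * R * (1 / 2)) ^ ε * lemma1I C' D' N R (1 / 2) * lemma1Norm ⌊N⌋₊ R (1 / 2) B

/-- Unfolding of `K1HalfFor`. [folklore] -/
theorem k1HalfFor_iff (g₀ : ℝ → ℝ → ℝ) (b : ℝ) :
    K1HalfFor g₀ b ↔
      ∀ ε : ℝ, 0 < ε → ∃ K : ℝ, ∀ C' D' N R : ℝ, 1 ≤ C' → 1 ≤ D' → 1 ≤ N → 1 / 2 ≤ R →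
        ∀ B : ℕ → ℕ → ℕ → ℂ,
          ‖dispK (fun c d => g₀ (c / C') (d / D')) ⌊b * C'⌋₊ ⌊b * D'⌋₊ ⌊N⌋₊ R (1 / 2) B‖ ≤
            K * (C' * D' * N * R * (1 / 2)) ^ ε * lemma1I C' D' N R (1 / 2) *
              lemma1Norm ⌊N⌋₊ R (1 / 2) B :=
  Iff.rfl

/-- **Any Lemma-1-type bound (all `S ≥ 1/2`) with the corrected `𝓘` gives the `S = 1/2` instance with
the misprinted `𝓘`**, for every weight. [cite: BombieriFriedlanderIwaniec2019, §2 Lemma 2.1] -/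
theorem k1HalfFor_of_corrected {g₀ : ℝ → ℝ → ℝ} {b : ℝ} (h : Lemma1BoundCorrected g₀ b) :
    K1HalfFor g₀ b := by
  intro ε hε
  obtain ⟨K, hK⟩ := h ε hε
  refine ⟨max K 0, fun C' D' N R hC hD hN hR B => ?_⟩
  have h1 := hK C' D' N R (1 / 2) hC hD hN hR le_rfl B
  refine h1.trans ?_
  have hx : 0 ≤ (C' * D' * N * R * (1 / 2)) ^ ε := Real.rpow_nonneg (by positivity) _
  have hn : 0 ≤ lemma1Norm ⌊N⌋₊ R (1 / 2) B := Real.sqrt_nonneg _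
  have hI : lemma1Icorr C' D' N R (1 / 2) ≤ lemma1I C' D' N R (1 / 2) :=
    lemma1Icorr_le_lemma1I (by linarith) (by linarith) (by norm_num) (by norm_num)
  have hI0 : 0 ≤ lemma1Icorr C' D' N R (1 / 2) := lemma1Icorr_nonneg _ _ _ _ _
  have step1 : K * ((C' * D' * N * R * (1 / 2)) ^ ε * lemma1Icorr C' D' N R (1 / 2) *
        lemma1Norm ⌊N⌋₊ R (1 / 2) B) ≤
      max K 0 * ((C' * D' * N * R * (1 / 2)) ^ ε * lemma1Icorr C' D' N R (1 / 2) *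
        lemma1Norm ⌊N⌋₊ R (1 / 2) B) :=
    mul_le_mul_of_nonneg_right (le_max_left _ _) (by positivity)
  have step2 : max K 0 * ((C' * D' * N * R * (1 / 2)) ^ ε * lemma1Icorr C' D' N R (1 / 2) *
        lemma1Norm ⌊N⌋₊ R (1 / 2) B) ≤
      max K 0 * ((C' * D' * N * R * (1 / 2)) ^ ε * lemma1I C' D' N R (1 / 2) *
        lemma1Norm ⌊N⌋₊ R (1 / 2) B) :=
    mul_le_mul_of_nonneg_left
      (mul_le_mul_of_nonneg_right (mul_le_mul_of_nonneg_left hI hx) hn) (le_max_right _ _)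
  calc K * (C' * D' * N * R * (1 / 2)) ^ ε * lemma1Icorr C' D' N R (1 / 2) * lemma1Norm ⌊N⌋₊ R (1 / 2) B
      = K * ((C' * D' * N * R * (1 / 2)) ^ ε * lemma1Icorr C' D' N R (1 / 2) *
          lemma1Norm ⌊N⌋₊ R (1 / 2) B) := by ring
    _ ≤ max K 0 * ((C' * D' * N * R * (1 / 2)) ^ ε * lemma1I C' D' N R (1 / 2) *
          lemma1Norm ⌊N⌋₊ R (1 / 2) B) := step1.trans step2
    _ = _ := by ring

/-- **The corrected Lemma 1 (BFI 2019, Lemma 2.1) for `w ⊗ w` gives the `S = 1/2` instance** used by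
the proofs of Lemmas 6 and 7. [cite: BombieriFriedlanderIwaniec2019, §2 Lemma 2.1] -/
theorem k1Half_of_corrected (h : Lemma1BoundCorrected plateau2 (5 / 4)) : K1HalfFor plateau2 (5 / 4) :=
  k1HalfFor_of_corrected h

/-- The (misprinted, false) predicate `Lemma1BoundFor plateau2 (5/4)` of `…Lemma6` trivially gives the
same instance (recorded only to relate the two reductions; that predicate is refuted in
`…Lemma1Refutation`). [folklore] -/
theorem k1Half_of_lemma1BoundFor {g₀ : ℝ → ℝ → ℝ} {b : ℝ} (h : Lemma1BoundFor g₀ b) : K1HalfFor g₀ b := by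
  intro ε hε
  obtain ⟨K, hK⟩ := h ε hε
  exact ⟨K, fun C' D' N R hC hD hN hR B => hK C' D' N R (1 / 2) hC hD hN hR le_rfl B⟩

namespace L6

/-! ### Lemma 6 from the `S = 1/2` instance (the proofs of `…Lemma6`, hypothesis weakened) -/

/-- **One smoothed block, from the `S = 1/2` instance of Lemma 1** — `BFI.L6.blockA_le_of_K1` with
its hypothesis restricted to `S = 1/2`, which is all its proof uses (BFI p. 227).
[cite: BombieriFriedlanderIwaniecActa1986, §8 p. 227] -/
theorem blockA_le_of_K1half {ε K₁ : ℝ} (hK₁0 : 0 ≤ K₁)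
    (hK₁ : ∀ C' D' N R : ℝ, 1 ≤ C' → 1 ≤ D' → 1 ≤ N → 1 / 2 ≤ R →
      ∀ B : ℕ → ℕ → ℕ → ℂ,
        ‖dispK (fun c d => plateau2 (c / C') (d / D')) ⌊5 / 4 * C'⌋₊ ⌊5 / 4 * D'⌋₊ ⌊N⌋₊ R (1 / 2) B‖ ≤
          K₁ * (C' * D' * N * R * (1 / 2)) ^ ε * lemma1I C' D' N R (1 / 2) *
            lemma1Norm ⌊N⌋₊ R (1 / 2) B)
    {A K H Q : ℕ} (hA : 1 ≤ A) (hK : 1 ≤ K) (hH : 1 ≤ H) (hQ : 1 ≤ Q)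
    {C' D' : ℝ} (hC' : 1 ≤ C') (hD' : 1 ≤ D') {α : ℕ → ℕ → ℂ} (hα : ∀ h q, ‖α h q‖ ≤ 1)
    {L : ℕ} (hL : Q * Q ≤ 2 ^ L) :
    blockA (A : ℤ) (fun c d => plateau2 (c / C') (d / D')) ⌊5 / 4 * C'⌋₊ ⌊5 / 4 * D'⌋₊ K H Q α ≤
      #(tsetZero K H Q) * ((⌊5 / 4 * C'⌋₊ : ℝ) * ⌊5 / 4 * D'⌋₊) +
        2 * ∑ l ∈ Finset.range (L + 1),
          K₁ * (C' * D' * ((A * K * (H * Q) : ℕ) : ℝ) * ((2 : ℝ) ^ l / 2) * (1 / 2)) ^ ε *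
            lemma1I C' D' ((A * K * (H * Q) : ℕ) : ℝ) ((2 : ℝ) ^ l / 2) (1 / 2) *
            Real.sqrt (∑ y ∈ Finset.Icc 1 (A * K * (H * Q)) ×ˢ Finset.Icc 1 (2 ^ L),
              ‖Bcoef A α K H Q y‖ ^ 2) := by
  set g : ℕ → ℕ → ℝ := fun c d => plateau2 (c / C') (d / D') with hg
  have hg0 : ∀ c d, 0 ≤ g c d := fun c d => plateau2_nonneg _ _
  set cM : ℕ := ⌊5 / 4 * C'⌋₊
  set dM : ℕ := ⌊5 / 4 * D'⌋₊
  set Nmax : ℕ := A * K * (H * Q) with hNmax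
  have hN1 : (1 : ℝ) ≤ (Nmax : ℝ) := by
    have : 1 ≤ Nmax := by
      have h1 : 1 * 1 ≤ A * K := Nat.mul_le_mul hA hK
      have h2 : 1 * 1 ≤ H * Q := Nat.mul_le_mul hH hQ
      have h3 : 1 * 1 ≤ (A * K) * (H * Q) := Nat.mul_le_mul (by simpa using h1) (by simpa using h2)
      simpa [hNmax] using h3
    exact_mod_cast this
  -- the two parts
  have hparts := blockA_le_parts (A : ℤ) g cM dM K H Q α
  have hZ0 := norm_Zpart_zero_le (A : ℤ) hg0 cM dM K H Q hα
  have hG : ∑ c ∈ Finset.Icc 1 cM, ∑ d ∈ Finset.Icc 1 dM, g c d ≤ (cM : ℝ) * dM :=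
    sum_sum_plateau2_le C' D' cM dM
  have hZpos : ‖Zpart (tsetPos K H Q) (A : ℤ) g cM dM α‖ ≤
      ∑ l ∈ Finset.range (L + 1),
        K₁ * (C' * D' * (Nmax : ℝ) * ((2 : ℝ) ^ l / 2) * (1 / 2)) ^ ε *
          lemma1I C' D' (Nmax : ℝ) ((2 : ℝ) ^ l / 2) (1 / 2) *
          Real.sqrt (∑ y ∈ Finset.Icc 1 Nmax ×ˢ Finset.Icc 1 (2 ^ L), ‖Bcoef A α K H Q y‖ ^ 2) := by
    rw [Zpart_pos_eq_sum_dispK hA g cM dM K H Q α hL]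
    refine (norm_sum_le _ _).trans (Finset.sum_le_sum fun l hl => ?_)
    have hlL : l ≤ L := Nat.lt_succ_iff.1 (Finset.mem_range.1 hl)
    have hR : (1 : ℝ) / 2 ≤ (2 : ℝ) ^ l / 2 := by
      have : (1 : ℝ) ≤ (2 : ℝ) ^ l := one_le_pow₀ (by norm_num)
      linarith
    have h := hK₁ C' D' (Nmax : ℝ) ((2 : ℝ) ^ l / 2) hC' hD' hN1 hR
      (fun n r _ => Bcoef A α K H Q (n, r))
    rw [Nat.floor_natCast] at h
    refine h.trans ?_
    refine mul_le_mul_of_nonneg_left (lemma1Norm_block_le Nmax hlL _) ?_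
    have : 0 ≤ lemma1I C' D' (Nmax : ℝ) ((2 : ℝ) ^ l / 2) (1 / 2) := Real.sqrt_nonneg _
    positivity
  calc blockA (A : ℤ) g cM dM K H Q α
      ≤ ‖Zpart (tsetZero K H Q) (A : ℤ) g cM dM α‖ + 2 * ‖Zpart (tsetPos K H Q) (A : ℤ) g cM dM α‖ := hparts
    _ ≤ #(tsetZero K H Q) * ((cM : ℝ) * dM) + 2 * ∑ l ∈ Finset.range (L + 1),
          K₁ * (C' * D' * (Nmax : ℝ) * ((2 : ℝ) ^ l / 2) * (1 / 2)) ^ ε *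
            lemma1I C' D' (Nmax : ℝ) ((2 : ℝ) ^ l / 2) (1 / 2) *
            Real.sqrt (∑ y ∈ Finset.Icc 1 Nmax ×ˢ Finset.Icc 1 (2 ^ L), ‖Bcoef A α K H Q y‖ ^ 2) := by
        have h1 : ‖Zpart (tsetZero K H Q) (A : ℤ) g cM dM α‖ ≤ #(tsetZero K H Q) * ((cM : ℝ) * dM) :=
          hZ0.trans (mul_le_mul_of_nonneg_left hG (Nat.cast_nonneg _))
        linarith

set_option maxHeartbeats 1600000 in
-- the final assembly of Lemma 6 (long but elementary bookkeeping), verbatim from `…Lemma6`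
/-- **BFI Lemma 6 for `a = A ≥ 1` from the `S = 1/2` instance of Lemma 1** (§8, (8.4), p. 227), in
the shape `𝒜 ≤ C₆ (CDHKQ)^η {CDHKQ + H(KQ)^{1/2}(H+Q)^{1/2} [bracket]^{1/2}}` — the statement and
proof of `BFI.L6.dispA_le_pos`, with the hypothesis weakened to `BFI.K1HalfFor BFI.plateau2 (5/4)`.
[cite: BombieriFriedlanderIwaniecActa1986, §8 Lemma 6 p. 227] -/
theorem dispA_le_pos_half (hLB : K1HalfFor plateau2 (5 / 4)) {A : ℕ} (hA : 1 ≤ A) {η : ℝ} (hη : 0 < η) :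
    ∃ C₆ : ℝ, ∀ C D K H Q : ℝ, 1 ≤ C → 1 ≤ D → 1 ≤ K → 1 ≤ H → 1 ≤ Q →
      ∀ α : ℕ → ℕ → ℂ, (∀ h q, ‖α h q‖ ≤ 1) →
        dispA (A : ℤ) C D K H Q α ≤
          C₆ * ((C * D * H * K * Q) ^ η * (C * D * H * K * Q +
            H * (K * Q) ^ (1 / 2 : ℝ) * (H + Q) ^ (1 / 2 : ℝ) * (bracket84 C D H K Q) ^ (1 / 2 : ℝ))) := by
  -- constants
  set δ : ℝ := η / 10 with hδ
  have hδ0 : 0 < δ := by positivity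
  obtain ⟨K', hK'⟩ := hLB δ hδ0
  set K₁ : ℝ := max K' 0 with hK₁
  have hK₁0 : 0 ≤ K₁ := le_max_right _ _
  have hK₁b : ∀ C' D' N R : ℝ, 1 ≤ C' → 1 ≤ D' → 1 ≤ N → 1 / 2 ≤ R →
      ∀ B : ℕ → ℕ → ℕ → ℂ,
        ‖dispK (fun c d => plateau2 (c / C') (d / D')) ⌊5 / 4 * C'⌋₊ ⌊5 / 4 * D'⌋₊ ⌊N⌋₊ R (1 / 2) B‖ ≤
          K₁ * (C' * D' * N * R * (1 / 2)) ^ δ * lemma1I C' D' N R (1 / 2) *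
            lemma1Norm ⌊N⌋₊ R (1 / 2) B := by
    intro C' D' N R h1 h2 h3 h4 B
    refine (hK' C' D' N R h1 h2 h3 h4 B).trans ?_
    have hx : 0 ≤ (C' * D' * N * R * (1 / 2)) ^ δ * lemma1I C' D' N R (1 / 2) *
        lemma1Norm ⌊N⌋₊ R (1 / 2) B := by
      have : 0 ≤ lemma1I C' D' N R (1 / 2) := Real.sqrt_nonneg _
      have : 0 ≤ lemma1Norm ⌊N⌋₊ R (1 / 2) B := Real.sqrt_nonneg _
      have : 0 ≤ (C' * D' * N * R * (1 / 2)) ^ δ := Real.rpow_nonneg (by positivity) _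
      positivity
    calc K' * (C' * D' * N * R * (1 / 2)) ^ δ * lemma1I C' D' N R (1 / 2) * lemma1Norm ⌊N⌋₊ R (1 / 2) B
        = K' * ((C' * D' * N * R * (1 / 2)) ^ δ * lemma1I C' D' N R (1 / 2) *
            lemma1Norm ⌊N⌋₊ R (1 / 2) B) := by ring
      _ ≤ K₁ * ((C' * D' * N * R * (1 / 2)) ^ δ * lemma1I C' D' N R (1 / 2) *
            lemma1Norm ⌊N⌋₊ R (1 / 2) B) :=
          mul_le_mul_of_nonneg_right (le_max_left _ _) hx
      _ = _ := by ring
  obtain ⟨Cδ, hCδ1, hτ⟩ := exists_card_divisors_le_mul_rpow' hδ0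
  have hlog2 : 0 < Real.log 2 := Real.log_pos one_lt_two
  set c₁ : ℝ := 1 / (δ * Real.log 2) + 2 with hc₁
  have hc₁0 : 0 ≤ c₁ := by positivity
  have hA' : (1 : ℝ) ≤ (A : ℝ) := by exact_mod_cast hA
  set V₀ : ℝ := K₁ * (2 * (A : ℝ)) ^ δ * Real.sqrt (8 * A) * Real.sqrt (2 * Cδ ^ 3 * (2 * A) ^ δ) with hV₀
  have hV₀0 : 0 ≤ V₀ := by positivity
  refine ⟨c₁ ^ 2 * (25 / 2 * Cδ) + 2 * c₁ ^ 3 * V₀, ?_⟩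
  intro C D K H Q hC hD hK hH hQ α hα
  obtain ⟨hP1, hCP, hDP, hHKQP, hQP⟩ := one_le_P hC hD hH hK hQ
  have hP0 : 0 < C * D * H * K * Q := by linarith
  -- the natural-number parameters
  have hK₀1 : 1 ≤ ⌊K⌋₊ := Nat.le_floor (by exact_mod_cast hK)
  have hH₀1 : 1 ≤ ⌊H⌋₊ := Nat.le_floor (by exact_mod_cast hH)
  have hQ₀1 : 1 ≤ ⌊Q⌋₊ := Nat.le_floor (by exact_mod_cast hQ)
  have hC₀1 : 1 ≤ ⌊C⌋₊ := Nat.le_floor (by exact_mod_cast hC)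
  have hD₀1 : 1 ≤ ⌊D⌋₊ := Nat.le_floor (by exact_mod_cast hD)
  have hK₀le : (⌊K⌋₊ : ℝ) ≤ K := Nat.floor_le (by linarith)
  have hH₀le : (⌊H⌋₊ : ℝ) ≤ H := Nat.floor_le (by linarith)
  have hQ₀le : (⌊Q⌋₊ : ℝ) ≤ Q := Nat.floor_le (by linarith)
  have hC₀le : (⌊C⌋₊ : ℝ) ≤ C := Nat.floor_le (by linarith)
  have hD₀le : (⌊D⌋₊ : ℝ) ≤ D := Nat.floor_le (by linarith)
  set L := Nat.log 2 (⌊Q⌋₊ * ⌊Q⌋₊) + 1 with hL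
  have hQQ1 : 1 ≤ ⌊Q⌋₊ * ⌊Q⌋₊ := by nlinarith
  have hQL : ⌊Q⌋₊ * ⌊Q⌋₊ ≤ 2 ^ L := (Nat.lt_pow_succ_log_self one_lt_two _).le
  have hQQle : ((⌊Q⌋₊ * ⌊Q⌋₊ : ℕ) : ℝ) ≤ Q ^ 2 := by
    push_cast
    nlinarith [Nat.cast_nonneg (α := ℝ) ⌊Q⌋₊]
  have h2L : ((2 ^ L : ℕ) : ℝ) ≤ 2 * Q ^ 2 := by
    have h1 : 2 ^ L ≤ 2 * (⌊Q⌋₊ * ⌊Q⌋₊) := by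
      rw [hL, pow_succ']
      exact Nat.mul_le_mul_left 2 (Nat.pow_log_le_self 2 (by omega))
    calc ((2 ^ L : ℕ) : ℝ) ≤ ((2 * (⌊Q⌋₊ * ⌊Q⌋₊) : ℕ) : ℝ) := by exact_mod_cast h1
      _ = 2 * ((⌊Q⌋₊ * ⌊Q⌋₊ : ℕ) : ℝ) := by push_cast; ring
      _ ≤ 2 * Q ^ 2 := by linarith
  -- abbreviations for the target pieces (genuine real numbers)
  have hW0 : 0 ≤ H * Real.sqrt (K * Q) * Real.sqrt (H + Q) := by positivity
  have hBr0 : 0 ≤ (bracket84 C D H K Q) ^ (1 / 2 : ℝ) :=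
    Real.rpow_nonneg (bracket84_nonneg (by linarith) (by linarith) (by linarith) (by linarith) (by linarith)) _
  have hPδ1 : 1 ≤ (C * D * H * K * Q) ^ δ := Real.one_le_rpow hP1 hδ0.le
  -- the uniform block bound
  have hblock : ∀ i ∈ Finset.range (Nat.log 2 ⌊C⌋₊ + 1 + 1), ∀ j ∈ Finset.range (Nat.log 2 ⌊D⌋₊ + 1 + 1),
      blockA (A : ℤ) (fun c d => plateau2 (c / (2 : ℝ) ^ i) (d / (2 : ℝ) ^ j))
        ⌊5 / 4 * (2 : ℝ) ^ i⌋₊ ⌊5 / 4 * (2 : ℝ) ^ j⌋₊ ⌊K⌋₊ ⌊H⌋₊ ⌊Q⌋₊ α ≤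
        25 / 2 * Cδ * (C * D * H * K * Q) * (C * D * H * K * Q) ^ δ +
          2 * (((L + 1 : ℕ) : ℝ) * (V₀ * ((C * D * H * K * Q) ^ (3 * δ) * (C * D * H * K * Q) ^ (2 * δ)) *
            (bracket84 C D H K Q) ^ (1 / 2 : ℝ) * (H * Real.sqrt (K * Q) * Real.sqrt (H + Q)))) := by
    intro i hi j hj
    have hi' : (2 : ℝ) ^ i ≤ 2 * C := two_pow_le_of_mem_range hC hi
    have hj' : (2 : ℝ) ^ j ≤ 2 * D := two_pow_le_of_mem_range hD hj
    have h1i : (1 : ℝ) ≤ (2 : ℝ) ^ i := one_le_pow₀ (by norm_num)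
    have h1j : (1 : ℝ) ≤ (2 : ℝ) ^ j := one_le_pow₀ (by norm_num)
    have hb := blockA_le_of_K1half hK₁0 hK₁b hA hK₀1 hH₀1 hQ₀1 h1i h1j hα hQL
    refine hb.trans (add_le_add ?_ (mul_le_mul_of_nonneg_left ?_ zero_le_two))
    · exact diag_term_le hCδ1 hδ0.le hτ hC hD hH hK hQ hK₀le hH₀le hQ₀le (by positivity) hi'
        (by positivity) hj'
    · have hN : ((A * ⌊K⌋₊ * (⌊H⌋₊ * ⌊Q⌋₊) : ℕ) : ℝ) ≤ (A : ℝ) * H * K * Q := by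
        push_cast
        calc (A : ℝ) * ⌊K⌋₊ * (⌊H⌋₊ * ⌊Q⌋₊) ≤ (A : ℝ) * K * (H * Q) := by gcongr
          _ = (A : ℝ) * H * K * Q := by ring
      have hl : ∀ l ∈ Finset.range (L + 1),
          K₁ * ((2 : ℝ) ^ i * (2 : ℝ) ^ j * ((A * ⌊K⌋₊ * (⌊H⌋₊ * ⌊Q⌋₊) : ℕ) : ℝ) * ((2 : ℝ) ^ l / 2) * (1 / 2)) ^ δ *
            lemma1I ((2 : ℝ) ^ i) ((2 : ℝ) ^ j) ((A * ⌊K⌋₊ * (⌊H⌋₊ * ⌊Q⌋₊) : ℕ) : ℝ) ((2 : ℝ) ^ l / 2) (1 / 2) *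
            Real.sqrt (∑ y ∈ Finset.Icc 1 (A * ⌊K⌋₊ * (⌊H⌋₊ * ⌊Q⌋₊)) ×ˢ Finset.Icc 1 (2 ^ L),
              ‖Bcoef A α ⌊K⌋₊ ⌊H⌋₊ ⌊Q⌋₊ y‖ ^ 2) ≤
          V₀ * ((C * D * H * K * Q) ^ (3 * δ) * (C * D * H * K * Q) ^ (2 * δ)) *
            (bracket84 C D H K Q) ^ (1 / 2 : ℝ) * (H * Real.sqrt (K * Q) * Real.sqrt (H + Q)) := by
        intro l hl
        have hlL : l ≤ L := Nat.lt_succ_iff.1 (Finset.mem_range.1 hl)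
        have hR : (2 : ℝ) ^ l / 2 ≤ Q ^ 2 := by
          have h1 : ((2 ^ l : ℕ) : ℝ) ≤ ((2 ^ L : ℕ) : ℝ) := by
            exact_mod_cast Nat.pow_le_pow_right (by norm_num) hlL
          push_cast at h1 h2L
          linarith
        have e1 := eps_factor_le hA' hC hD hH hK hQ (by positivity) hi' (by positivity) hj'
          (Nat.cast_nonneg _) hN (by positivity) hR hδ0.le
        have e2 := lemma1I_le hA' hC hD hH hK hQ (by positivity) hi' (by positivity) hj'
          (Nat.cast_nonneg _) hN (by positivity) hR
        have e3 := sqrt_boxsum_le hA hα hCδ1 hδ0.le hτ hC hD hH hK hQ hK₀le hH₀le hQ₀le h2L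
        have hI0 : 0 ≤ lemma1I ((2 : ℝ) ^ i) ((2 : ℝ) ^ j) ((A * ⌊K⌋₊ * (⌊H⌋₊ * ⌊Q⌋₊) : ℕ) : ℝ)
            ((2 : ℝ) ^ l / 2) (1 / 2) := Real.sqrt_nonneg _
        calc K₁ * ((2 : ℝ) ^ i * (2 : ℝ) ^ j * ((A * ⌊K⌋₊ * (⌊H⌋₊ * ⌊Q⌋₊) : ℕ) : ℝ) * ((2 : ℝ) ^ l / 2) * (1 / 2)) ^ δ *
              lemma1I ((2 : ℝ) ^ i) ((2 : ℝ) ^ j) ((A * ⌊K⌋₊ * (⌊H⌋₊ * ⌊Q⌋₊) : ℕ) : ℝ) ((2 : ℝ) ^ l / 2) (1 / 2) *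
              Real.sqrt (∑ y ∈ Finset.Icc 1 (A * ⌊K⌋₊ * (⌊H⌋₊ * ⌊Q⌋₊)) ×ˢ Finset.Icc 1 (2 ^ L),
                ‖Bcoef A α ⌊K⌋₊ ⌊H⌋₊ ⌊Q⌋₊ y‖ ^ 2)
            ≤ K₁ * ((2 * (A : ℝ)) ^ δ * (C * D * H * K * Q) ^ (3 * δ)) *
              (Real.sqrt (8 * A) * (bracket84 C D H K Q) ^ (1 / 2 : ℝ)) *
              (Real.sqrt (2 * Cδ ^ 3 * (2 * A) ^ δ) * (C * D * H * K * Q) ^ (2 * δ) *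
                (H * Real.sqrt (K * Q) * Real.sqrt (H + Q))) := by
              gcongr
          _ = V₀ * ((C * D * H * K * Q) ^ (3 * δ) * (C * D * H * K * Q) ^ (2 * δ)) *
              (bracket84 C D H K Q) ^ (1 / 2 : ℝ) * (H * Real.sqrt (K * Q) * Real.sqrt (H + Q)) := by
              rw [hV₀]; ring
      calc ∑ l ∈ Finset.range (L + 1),
            K₁ * ((2 : ℝ) ^ i * (2 : ℝ) ^ j * ((A * ⌊K⌋₊ * (⌊H⌋₊ * ⌊Q⌋₊) : ℕ) : ℝ) * ((2 : ℝ) ^ l / 2) * (1 / 2)) ^ δ *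
              lemma1I ((2 : ℝ) ^ i) ((2 : ℝ) ^ j) ((A * ⌊K⌋₊ * (⌊H⌋₊ * ⌊Q⌋₊) : ℕ) : ℝ) ((2 : ℝ) ^ l / 2) (1 / 2) *
              Real.sqrt (∑ y ∈ Finset.Icc 1 (A * ⌊K⌋₊ * (⌊H⌋₊ * ⌊Q⌋₊)) ×ˢ Finset.Icc 1 (2 ^ L),
                ‖Bcoef A α ⌊K⌋₊ ⌊H⌋₊ ⌊Q⌋₊ y‖ ^ 2)
          ≤ ∑ l ∈ Finset.range (L + 1),
              V₀ * ((C * D * H * K * Q) ^ (3 * δ) * (C * D * H * K * Q) ^ (2 * δ)) *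
                (bracket84 C D H K Q) ^ (1 / 2 : ℝ) * (H * Real.sqrt (K * Q) * Real.sqrt (H + Q)) :=
            Finset.sum_le_sum hl
        _ = _ := by rw [Finset.sum_const, Finset.card_range, nsmul_eq_mul]
  -- sum over the blocks
  have hA1 := dispA_le_sum_blockA (A : ℤ) C D K H Q α
  set U : ℝ := 25 / 2 * Cδ * (C * D * H * K * Q) * (C * D * H * K * Q) ^ δ +
    2 * (((L + 1 : ℕ) : ℝ) * (V₀ * ((C * D * H * K * Q) ^ (3 * δ) * (C * D * H * K * Q) ^ (2 * δ)) *
      (bracket84 C D H K Q) ^ (1 / 2 : ℝ) * (H * Real.sqrt (K * Q) * Real.sqrt (H + Q)))) with hU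
  have hA2 : dispA (A : ℤ) C D K H Q α ≤
      ((Nat.log 2 ⌊C⌋₊ + 1 + 1 : ℕ) : ℝ) * (((Nat.log 2 ⌊D⌋₊ + 1 + 1 : ℕ) : ℝ) * U) := by
    refine hA1.trans ?_
    calc ∑ i ∈ Finset.range (Nat.log 2 ⌊C⌋₊ + 1 + 1), ∑ j ∈ Finset.range (Nat.log 2 ⌊D⌋₊ + 1 + 1),
          blockA (A : ℤ) (fun c d => plateau2 (c / (2 : ℝ) ^ i) (d / (2 : ℝ) ^ j))
            ⌊5 / 4 * (2 : ℝ) ^ i⌋₊ ⌊5 / 4 * (2 : ℝ) ^ j⌋₊ ⌊K⌋₊ ⌊H⌋₊ ⌊Q⌋₊ α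
        ≤ ∑ i ∈ Finset.range (Nat.log 2 ⌊C⌋₊ + 1 + 1), ∑ j ∈ Finset.range (Nat.log 2 ⌊D⌋₊ + 1 + 1), U :=
          Finset.sum_le_sum fun i hi => Finset.sum_le_sum fun j hj => hblock i hi j hj
      _ = _ := by
          rw [Finset.sum_const, Finset.card_range, nsmul_eq_mul, Finset.sum_const, Finset.card_range,
            nsmul_eq_mul]
  -- the counting factors
  have hcC : ((Nat.log 2 ⌊C⌋₊ + 1 + 1 : ℕ) : ℝ) ≤ c₁ * (C * D * H * K * Q) ^ δ := by
    have h := natLog_two_add_two_le hC₀1 hC₀le hδ0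
    push_cast at h ⊢
    refine (by linarith : (Nat.log 2 ⌊C⌋₊ : ℝ) + 1 + 1 ≤ (1 / (δ * Real.log 2) + 2) * C ^ δ).trans ?_
    exact mul_le_mul_of_nonneg_left (Real.rpow_le_rpow (by linarith) hCP hδ0.le) hc₁0
  have hcD : ((Nat.log 2 ⌊D⌋₊ + 1 + 1 : ℕ) : ℝ) ≤ c₁ * (C * D * H * K * Q) ^ δ := by
    have h := natLog_two_add_two_le hD₀1 hD₀le hδ0
    push_cast at h ⊢
    refine (by linarith : (Nat.log 2 ⌊D⌋₊ : ℝ) + 1 + 1 ≤ (1 / (δ * Real.log 2) + 2) * D ^ δ).trans ?_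
    exact mul_le_mul_of_nonneg_left (Real.rpow_le_rpow (by linarith) hDP hδ0.le) hc₁0
  have hcL : ((L + 1 : ℕ) : ℝ) ≤ c₁ * (C * D * H * K * Q) ^ (2 * δ) := by
    have h := natLog_two_add_two_le (x := Q ^ 2) hQQ1 hQQle hδ0
    rw [hL]
    push_cast at h ⊢
    refine (by linarith : (Nat.log 2 (⌊Q⌋₊ * ⌊Q⌋₊) : ℝ) + 1 + 1 ≤ (1 / (δ * Real.log 2) + 2) * (Q ^ 2) ^ δ).trans ?_
    have e : (Q ^ 2) ^ δ = Q ^ (2 * δ) := by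
      rw [← Real.rpow_natCast, ← Real.rpow_mul (by linarith)]; norm_num
    rw [e]
    exact mul_le_mul_of_nonneg_left (Real.rpow_le_rpow (by linarith) hQP (by positivity)) hc₁0
  -- powers of `p = P^δ`
  set p : ℝ := (C * D * H * K * Q) ^ δ with hp
  have hp1 : 1 ≤ p := hPδ1
  have hp2 : (C * D * H * K * Q) ^ (2 * δ) = p ^ 2 := by
    rw [hp, ← Real.rpow_natCast, ← Real.rpow_mul hP0.le]; ring_nf
  have hp3 : (C * D * H * K * Q) ^ (3 * δ) = p ^ 3 := by
    rw [hp, ← Real.rpow_natCast, ← Real.rpow_mul hP0.le]; ring_nf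
  have hpη : (C * D * H * K * Q) ^ η = p ^ 10 := by
    rw [hp, ← Real.rpow_natCast, ← Real.rpow_mul hP0.le, hδ]; ring_nf
  rw [hp2, hp3] at hU
  rw [hp2] at hcL
  -- final algebra
  set P := C * D * H * K * Q with hPdef
  set W := H * Real.sqrt (K * Q) * Real.sqrt (H + Q) with hWdef
  set Br := (bracket84 C D H K Q) ^ (1 / 2 : ℝ) with hBrdef
  have hWrpow : H * (K * Q) ^ (1 / 2 : ℝ) * (H + Q) ^ (1 / 2 : ℝ) = W := by
    rw [hWdef, Real.sqrt_eq_rpow, Real.sqrt_eq_rpow]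
  rw [hWrpow, hpη]
  have hP0' : 0 ≤ P := hP0.le
  have hLp : ((L + 1 : ℕ) : ℝ) ≤ c₁ * p ^ 2 := hcL
  -- `U ≤ (25/2)Cδ P p + 2 c₁ p² V₀ p³ p² Br W`
  have hU1 : U ≤ 25 / 2 * Cδ * P * p + 2 * (c₁ * p ^ 2 * (V₀ * (p ^ 3 * p ^ 2) * Br * W)) := by
    rw [hU]
    have hx : 0 ≤ V₀ * (p ^ 3 * p ^ 2) * Br * W := by positivity
    nlinarith [mul_le_mul_of_nonneg_right hLp hx]
  have hU0 : 0 ≤ U := by rw [hU]; positivity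
  -- `dispA ≤ (c₁ p)(c₁ p) U`
  have hA3 : dispA (A : ℤ) C D K H Q α ≤ (c₁ * p) * ((c₁ * p) * U) := by
    refine hA2.trans ?_
    have h2 : ((Nat.log 2 ⌊D⌋₊ + 1 + 1 : ℕ) : ℝ) * U ≤ (c₁ * p) * U := mul_le_mul_of_nonneg_right hcD hU0
    calc ((Nat.log 2 ⌊C⌋₊ + 1 + 1 : ℕ) : ℝ) * (((Nat.log 2 ⌊D⌋₊ + 1 + 1 : ℕ) : ℝ) * U)
        ≤ ((Nat.log 2 ⌊C⌋₊ + 1 + 1 : ℕ) : ℝ) * ((c₁ * p) * U) :=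
          mul_le_mul_of_nonneg_left h2 (Nat.cast_nonneg _)
      _ ≤ (c₁ * p) * ((c₁ * p) * U) := mul_le_mul_of_nonneg_right hcC (by positivity)
  refine hA3.trans ?_
  -- polynomial bookkeeping in `p ≥ 1`
  have hp0 : 0 ≤ p := by linarith
  have hp3le : p ^ 3 ≤ p ^ 10 := pow_le_pow_right₀ hp1 (by norm_num)
  have hp9le : p ^ 9 ≤ p ^ 10 := pow_le_pow_right₀ hp1 (by norm_num)
  have hCδ0 : 0 ≤ Cδ := by linarith
  have hBW : 0 ≤ Br * W := mul_nonneg hBr0 hW0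
  calc (c₁ * p) * ((c₁ * p) * U)
      ≤ (c₁ * p) * ((c₁ * p) * (25 / 2 * Cδ * P * p + 2 * (c₁ * p ^ 2 * (V₀ * (p ^ 3 * p ^ 2) * Br * W)))) := by
        gcongr
    _ = c₁ ^ 2 * (25 / 2 * Cδ) * (p ^ 3 * P) + 2 * c₁ ^ 3 * V₀ * (p ^ 9 * (Br * W)) := by ring
    _ ≤ c₁ ^ 2 * (25 / 2 * Cδ) * (p ^ 10 * P) + 2 * c₁ ^ 3 * V₀ * (p ^ 10 * (Br * W)) := by
        gcongr
    _ ≤ (c₁ ^ 2 * (25 / 2 * Cδ) + 2 * c₁ ^ 3 * V₀) * (p ^ 10 * P) +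
          (c₁ ^ 2 * (25 / 2 * Cδ) + 2 * c₁ ^ 3 * V₀) * (p ^ 10 * (Br * W)) := by
        have h1 : 0 ≤ 2 * c₁ ^ 3 * V₀ * (p ^ 10 * P) := by positivity
        have h2 : 0 ≤ c₁ ^ 2 * (25 / 2 * Cδ) * (p ^ 10 * (Br * W)) := by positivity
        nlinarith
    _ = (c₁ ^ 2 * (25 / 2 * Cδ) + 2 * c₁ ^ 3 * V₀) * (p ^ 10 * (P + W * Br)) := by ring

/-- **BFI 1986, Lemma 6 (§8, (8.4), p. 227) from the `S = 1/2` instance of Lemma 1**, in exactly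
the shape consumed by `BombieriFriedlanderIwaniecTheorem5_of_lemma6` and
`BombieriFriedlanderIwaniecTheorem1_of_lemma6` (both signs of `a`, via `BFI.L6.dispA_neg`).
[cite: BombieriFriedlanderIwaniecActa1986, §8 Lemma 6 p. 227] -/
theorem dispA_le_of_K1half (hLB : K1HalfFor plateau2 (5 / 4)) :
    ∀ a : ℤ, a ≠ 0 → ∀ η : ℝ, 0 < η → ∃ C₆ : ℝ, ∀ C D K H Q : ℝ,
      1 ≤ C → 1 ≤ D → 1 ≤ K → 1 ≤ H → 1 ≤ Q → ∀ α : ℕ → ℕ → ℂ, (∀ h q, ‖α h q‖ ≤ 1) →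
        dispA a C D K H Q α ≤ C₆ * ((C * D * H * K * Q) ^ η *
          (C * D * H * K * Q + H * (K * Q) ^ (1 / 2 : ℝ) * (H + Q) ^ (1 / 2 : ℝ) *
            (C * (Q ^ 2 + H * K * Q) * (C + D * Q ^ 2) +
              C ^ 2 * D * Q * (Q ^ 2 + H * K * Q) ^ (1 / 2 : ℝ) +
                D ^ 2 * H * K * Q ^ 3) ^ (1 / 2 : ℝ))) := by
  intro a ha η hη
  have hA : 1 ≤ a.natAbs := Int.natAbs_pos.2 ha
  obtain ⟨C₆, hC₆⟩ := dispA_le_pos_half hLB hA hη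
  refine ⟨C₆, fun C D K H Q hC hD hK hH hQ α hα => ?_⟩
  rcases le_or_gt 0 a with h0 | h0
  · have e : a = (a.natAbs : ℤ) := (Int.natAbs_of_nonneg h0).symm
    rw [e]
    exact hC₆ C D K H Q hC hD hK hH hQ α hα
  · have e : a = -(a.natAbs : ℤ) := by
      rw [Int.ofNat_natAbs_of_nonpos h0.le]; ring
    rw [e, dispA_neg]
    refine hC₆ C D K H Q hC hD hK hH hQ (fun h q => conj (α h q)) fun h q => ?_
    rw [Complex.norm_conj]
    exact hα h q

/-- **BFI Lemma 6 from the corrected Lemma 1 (BFI 2019, Lemma 2.1)** for the weight `w ⊗ w`.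
[cite: BombieriFriedlanderIwaniec2019, §2 Lemma 2.1; BombieriFriedlanderIwaniecActa1986, §8 Lemma 6 p. 227] -/
theorem dispA_le_of_lemma1corr (h : Lemma1BoundCorrected plateau2 (5 / 4)) :
    ∀ a : ℤ, a ≠ 0 → ∀ η : ℝ, 0 < η → ∃ C₆ : ℝ, ∀ C D K H Q : ℝ,
      1 ≤ C → 1 ≤ D → 1 ≤ K → 1 ≤ H → 1 ≤ Q → ∀ α : ℕ → ℕ → ℂ, (∀ h q, ‖α h q‖ ≤ 1) →
        dispA a C D K H Q α ≤ C₆ * ((C * D * H * K * Q) ^ η *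
          (C * D * H * K * Q + H * (K * Q) ^ (1 / 2 : ℝ) * (H + Q) ^ (1 / 2 : ℝ) *
            (C * (Q ^ 2 + H * K * Q) * (C + D * Q ^ 2) +
              C ^ 2 * D * Q * (Q ^ 2 + H * K * Q) ^ (1 / 2 : ℝ) +
                D ^ 2 * H * K * Q ^ 3) ^ (1 / 2 : ℝ))) :=
  dispA_le_of_K1half (k1Half_of_corrected h)

end L6

end BFI

/-! ### Theorems 5, 5*, 5* on boxes and Theorem 1 from the corrected Lemma 1 -/

open BFI

/-- **BFI 1986, Theorem 5 (§12, p. 237) from the CORRECTED Lemma 1** (BFI 2019, Lemma 2.1 = the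
corrected Theorem 12 of Deshouillers–Iwaniec 1982), for the weight `w ⊗ w` in the ranges
`C, D, N ≥ 1`, `R, S ≥ 1/2` (hypothesis `BFI.Lemma1BoundCorrected BFI.plateau2 (5/4)`): Lemma 6 from
its `S = 1/2` instance (this file) and `BombieriFriedlanderIwaniecTheorem5_of_lemma6` (tree).  This
supersedes `BombieriFriedlanderIwaniecTheorem5_of_lemma1`, whose hypothesis is the misprinted (false)
form of Lemma 1. [cite: BombieriFriedlanderIwaniec2019, §2 Lemma 2.1; BombieriFriedlanderIwaniecActa1986, §12 Theorem 5 p. 237] -/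
theorem BombieriFriedlanderIwaniecTheorem5_of_lemma1corr (h : BFI.Lemma1BoundCorrected BFI.plateau2 (5 / 4)) :
    BombieriFriedlanderIwaniecTheorem5 :=
  BombieriFriedlanderIwaniecTheorem5_of_lemma6 (BFI.L6.dispA_le_of_lemma1corr h)

/-- **Theorem 5 from the `S = 1/2` instance of Lemma 1 alone** (`BFI.K1HalfFor BFI.plateau2 (5/4)`).
[cite: BombieriFriedlanderIwaniecActa1986, §12 Theorem 5 p. 237; §8 p. 227] -/
theorem BombieriFriedlanderIwaniecTheorem5_of_k1Half (h : BFI.K1HalfFor BFI.plateau2 (5 / 4)) : BombieriFriedlanderIwaniecTheorem5 :=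
  BombieriFriedlanderIwaniecTheorem5_of_lemma6 (BFI.L6.dispA_le_of_K1half h)

/-- **Theorem 5 from the corrected Lemma 1 quantified over all smooth weights** (the printed form
of BFI 2019 Lemma 2.1: `g₀` smooth with compact support in `ℝ⁺ × ℝ⁺`, rendered as support in a box
`[a, b]²`, `0 < a ≤ b`). [cite: BombieriFriedlanderIwaniec2019, §2 Lemma 2.1] -/
theorem BombieriFriedlanderIwaniecTheorem5_of_lemma1corr'
    (h1 : ∀ g₀ : ℝ → ℝ → ℝ, ContDiff ℝ ∞ (fun p : ℝ × ℝ => g₀ p.1 p.2) →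
      ∀ a b : ℝ, 0 < a → a ≤ b →
        (∀ ξ η : ℝ, ¬ (ξ ∈ Set.Icc a b ∧ η ∈ Set.Icc a b) → g₀ ξ η = 0) →
          BFI.Lemma1BoundCorrected g₀ b) :
    BombieriFriedlanderIwaniecTheorem5 :=
  BombieriFriedlanderIwaniecTheorem5_of_lemma1corr
    (h1 BFI.plateau2 BFI.contDiff_plateau2 (1 / 4) (5 / 4) (by norm_num) (by norm_num)
      fun _ _ h => BFI.plateau2_eq_zero h)

/-- **Theorem 5* on boxes (the named fact `BombieriFriedlanderIwaniecTheorem5StarInterval`) from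
the corrected Lemma 1.** [cite: BombieriFriedlanderIwaniec2019, §2 Lemma 2.1; BombieriFriedlanderIwaniecActa1986, §12 Theorem 5* p. 238, §15 p. 246] -/
theorem BombieriFriedlanderIwaniecTheorem5StarInterval_of_lemma1corr
    (h : BFI.Lemma1BoundCorrected BFI.plateau2 (5 / 4)) : BombieriFriedlanderIwaniecTheorem5StarInterval :=
  BombieriFriedlanderIwaniecTheorem5StarInterval_of_theorem5 (BombieriFriedlanderIwaniecTheorem5_of_lemma1corr h)

/-- **Theorem 5* as printed (the named fact `BombieriFriedlanderIwaniecTheorem5Star`) from the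
corrected Lemma 1.** [cite: BombieriFriedlanderIwaniec2019, §2 Lemma 2.1; BombieriFriedlanderIwaniecActa1986, §12 Theorem 5* p. 238] -/
theorem BombieriFriedlanderIwaniecTheorem5Star_of_lemma1corr
    (h : BFI.Lemma1BoundCorrected BFI.plateau2 (5 / 4)) : BombieriFriedlanderIwaniecTheorem5Star :=
  BombieriFriedlanderIwaniecTheorem5Star_of_theorem5 (BombieriFriedlanderIwaniecTheorem5_of_lemma1corr h)

/-- **BFI 1986, Theorem 1 (§8, p. 225) from the CORRECTED Lemma 1** (BFI 2019, Lemma 2.1), for the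
weight `w ⊗ w`: Lemma 6 from its `S = 1/2` instance (this file) and
`BombieriFriedlanderIwaniecTheorem1_of_lemma6` (tree, `…Theorem1Assembly`).  Supersedes
`BombieriFriedlanderIwaniecTheorem1_of_lemma1` (misprinted hypothesis).
[cite: BombieriFriedlanderIwaniec2019, §2 Lemma 2.1; BombieriFriedlanderIwaniecActa1986, §8 Theorem 1 p. 225] -/
theorem BombieriFriedlanderIwaniecTheorem1_of_lemma1corr (h : BFI.Lemma1BoundCorrected BFI.plateau2 (5 / 4)) :
    BombieriFriedlanderIwaniecTheorem1 :=
  BombieriFriedlanderIwaniecTheorem1_of_lemma6 (BFI.L6.dispA_le_of_lemma1corr h)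

/-- **Theorem 1 from the `S = 1/2` instance of Lemma 1 alone** (`BFI.K1HalfFor BFI.plateau2 (5/4)`).
[cite: BombieriFriedlanderIwaniecActa1986, §8 Theorem 1 p. 225, p. 227] -/
theorem BombieriFriedlanderIwaniecTheorem1_of_k1Half (h : BFI.K1HalfFor BFI.plateau2 (5 / 4)) : BombieriFriedlanderIwaniecTheorem1 :=
  BombieriFriedlanderIwaniecTheorem1_of_lemma6 (BFI.L6.dispA_le_of_K1half h)

end Literature.NumberTheory.Sieve
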